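import Literature.Probability.LatticeModels.LebowitzInequality
import HarnessLib

/-!
# The covariance of two bond energies is bounded by four truncated two-point functions —
# ferromagnetic Ising model WITH fields ∕ plus boundary condition (Duminil-Copin–Goswami–Raoufi 2020,
# Lemma 1.2 for `|A| = |B| = 2`; Lebowitz 1974 ∕ Glimm–Jaffe Cor. 4.3.2) — PROVED

H. Duminil-Copin, S. Goswami, A. Raoufi, Comm. Math. Phys. **374** (2020), arXiv:1808.00439
[DuminilCopinGoswamiRaoufi2020], **Lemma 1.2**: «For every finite graph `G`, every `β > β_c` and every
two sets of vertices `A` and `B`,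
`0 ≤ ⟨σ_Aσ_B⟩⁺_{G,β} - ⟨σ_A⟩⁺_{G,β}⟨σ_B⟩⁺_{G,β} ≤ 2^{|A|+|B|-4} ∑_{a ∈ A, b ∈ B} ⟨σ_a;σ_b⟩⁺_{G,β}`»
(proof there: switching lemma for random currents). This file PROVES the case `|A| = |B| = 2`
(constant `2⁰ = 1`) — the one needed to control ENERGY–ENERGY covariances by the truncated two-point
function — for every finite-volume ferromagnetic Ising system with nonnegative pair couplings AND
nonnegative fields (so for the free and the PLUS boundary condition with `h ≥ 0`; the restriction
`β > β_c` of the printed lemma plays no role in finite volume), by Lebowitz' third inequality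
`⟨t^Aq^B⟩ ≤ ⟨t^A⟩⟨q^B⟩` in the duplicated system (Glimm–Jaffe 1987 Cor. 4.3.2 — the tree's
`lebowitz_pair`, which allows fields), instead of currents:

`Cov(σ_aσ_z, σ_xσ_y) = ⅛ ∑ ⟨T T Q Q⟩` over the four splittings (`cov_spinPair_eq_gksSum2`),
`⟨T_uT_vQ_pQ_r⟩ ≤ ⟨T_uT_v⟩⟨Q_pQ_r⟩ ≤ 4 ⟨Q_pQ_r⟩ = 8 ⟨σ_p;σ_r⟩` (`T = σ + σ'`, `Q = σ - σ'`,
`⟨T_uT_v⟩ ≤ 4`, `⟨Q_pQ_r⟩ = 2⟨σ_p;σ_r⟩ ≥ 0` by GKS II), whence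
**`⟨σ_aσ_zσ_xσ_y⟩ - ⟨σ_aσ_z⟩⟨σ_xσ_y⟩ ≤ ⟨σ_a;σ_x⟩ + ⟨σ_a;σ_y⟩ + ⟨σ_z;σ_x⟩ + ⟨σ_z;σ_y⟩`**.
At zero field this is weaker than the tree's `gksExpect_connectedFour_nonpos` (Lebowitz `U₄ ≤ 0`),
but it survives a magnetic field ∕ plus boundary condition, where `U₄ ≤ 0` is not available.

* `gksSum2_ttqq_le_four_mul_qq`, `gksExpect_cov_spinPair_le_sum_truncated` — the spin system
  `ν_{Λ;K}`, `Kᵢ ≥ 0` on supports of at most two sites;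
* `isingCorr_cov_pair_le_sum_truncated` — the finite-volume Ising model on a locally finite graph,
  free or plus boundary condition, `β, h ≥ 0` (sets written as symmetric differences of singletons,
  `σ_uσ_v = σ_{{u}∆{v}}`, so that coincident sites need no separate treatment);
* `plusCorr_cov_pair_le_sum_truncated`, `freeCorr_cov_pair_le_sum_truncated` — the plus and free
  states of `ℤ^d` (box limits `hasBoxLimit_isingCorr_plus_holds` ∕ `_free_holds`).

Consumer: the confined-phase plaquette–plaquette bound of `ℤ₂` lattice gauge theory on `ℤ³`
(`IsingGaugePlaquetteCovarianceDuality.lean`, cell `ym-ir` census row A5), where the dual Ising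
model is in its PLUS state above `β_c` and the only remaining input is DCGR's Thm 1.1
(`DuminilCopinGoswamiRaoufi2020_truncatedTwoPointPlus_expDecay`).

## References

* H. Duminil-Copin, S. Goswami, A. Raoufi, CMP 374 (2020) 891–921, arXiv:1808.00439, Lemma 1.2.
  [DuminilCopinGoswamiRaoufi2020]
* J. Glimm, A. Jaffe, *Quantum Physics*, 2nd ed. (1987), §4.3, Cor. 4.3.2 (third inequality) and the
  proof of (4.1.11). [GlimmJaffe1987]
* J. L. Lebowitz, Comm. Math. Phys. 35 (1974) 87–92, (2.5b). [Lebowitz1974]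
-/

noncomputable section

open Finset Filter Topology
open scoped symmDiff

namespace Literature.Probability.LatticeModels

/-! ### §1 The spin system `ν_{Λ;K}` with fields: `Cov(σ_aσ_z, σ_xσ_y) ≤ ∑ ⟨σ_p;σ_r⟩` -/

section GKS

variable {Λ : Type*} [Fintype Λ] [DecidableEq Λ] {ι : Type*}
variable (s : Finset ι) (K : ι → ℝ) (C : ι → Finset Λ)

/-- `Z⟨σ_uσ_v⟩ ≤ Z` (`|σ_uσ_v| ≤ 1`). [folklore] -/
private theorem gksSum_spinPair_le_one (u v : Λ) :
    gksSum s K C (spinPair u v) ≤ gksSum s K C (fun _ => 1) := by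
  unfold gksSum
  refine Finset.sum_le_sum fun ω _ => ?_
  have hw := gksWeight_pos s K C ω
  have h1 : spinPair u v ω ≤ 1 := by
    unfold spinPair
    rcases spinAt_eq_one_or_eq_neg_one u ω with h | h <;>
      rcases spinAt_eq_one_or_eq_neg_one v ω with h' | h' <;> rw [h, h'] <;> norm_num
  nlinarith

/-- `∑∑ T_uT_v ww ≤ 4 Z²` (`⟨T_uT_v⟩ = 2⟨σ_uσ_v⟩ + 2⟨σ_u⟩⟨σ_v⟩ ≤ 4`; GKS II bounds the second term
by the first). [cite: GlimmJaffe1987, §4.1, eq. (4.1.7)–(4.1.8)] -/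
theorem gksSum2_tVar2_mul_le [DecidableEq ι] (hK : ∀ i ∈ s, 0 ≤ K i) (u v : Λ) :
    gksSum2 s K C (fun ξ χ => tVar2 u ξ χ * tVar2 v ξ χ) ≤
      4 * (gksSum s K C (fun _ => 1) * gksSum s K C (fun _ => 1)) := by
  rw [gksSum2_tVar2_mul]
  have h1 := gksSum_spinAt_mul_le s K C hK u v
  have h2 := gksSum_spinPair_le_one s K C u v
  have hZ := gksSum_one_pos s K C
  nlinarith

/-- `∑∑ Q_pQ_r ww = 2(Z·Z⟨σ_pσ_r⟩ - Z⟨σ_p⟩Z⟨σ_r⟩) ≥ 0` (GKS II with fields). [cite: GlimmJaffe1987, Cor. 4.3.2 (second inequality, ⟨q_Aq_B⟩ ≥ ⟨q_A⟩⟨q_B⟩ ≥ 0)] -/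
theorem gksSum2_qVar2_mul_nonneg [DecidableEq ι] (hK : ∀ i ∈ s, 0 ≤ K i) (p r : Λ) :
    0 ≤ gksSum2 s K C (fun ξ χ => qVar2 p ξ χ * qVar2 r ξ χ) := by
  rw [gksSum2_qVar2_mul]
  linarith [gksSum_spinAt_mul_le s K C hK p r]

/-- **One Lebowitz term, keeping the truncation**: `∑∑ T_uT_vQ_pQ_r ww ≤ 4 ∑∑ Q_pQ_r ww`, from
`⟨T_uT_vQ_pQ_r⟩ ≤ ⟨T_uT_v⟩⟨Q_pQ_r⟩` (`lebowitz_pair`) and `⟨T_uT_v⟩ ≤ 4`, `⟨Q_pQ_r⟩ ≥ 0`.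
[cite: GlimmJaffe1987, Cor. 4.3.2 (third inequality); Lebowitz1974 (2.5b)] -/
theorem gksSum2_ttqq_le_four_mul_qq [DecidableEq ι] (hK : ∀ i ∈ s, 0 ≤ K i)
    (hC : ∀ i ∈ s, (C i).card ≤ 2) (u v p r : Λ) :
    gksSum2 s K C (fun ξ χ => tVar2 u ξ χ * tVar2 v ξ χ * (qVar2 p ξ χ * qVar2 r ξ χ)) ≤
      4 * gksSum2 s K C (fun ξ χ => qVar2 p ξ χ * qVar2 r ξ χ) := by
  have hZ := gksSum_one_pos s K C
  have hleb := lebowitz_pair s K C hK hC u v p r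
  rw [gksSum2_one] at hleb
  have hT := gksSum2_tVar2_mul_le s K C hK u v
  have hQ := gksSum2_qVar2_mul_nonneg s K C hK p r
  have hZ2 : 0 < gksSum s K C (fun _ => 1) * gksSum s K C (fun _ => 1) := mul_pos hZ hZ
  have h' : gksSum2 s K C (fun ξ χ => tVar2 u ξ χ * tVar2 v ξ χ * (qVar2 p ξ χ * qVar2 r ξ χ)) *
      (gksSum s K C (fun _ => 1) * gksSum s K C (fun _ => 1)) ≤
      4 * gksSum2 s K C (fun ξ χ => qVar2 p ξ χ * qVar2 r ξ χ) *
        (gksSum s K C (fun _ => 1) * gksSum s K C (fun _ => 1)) :=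
    calc _ ≤ _ := hleb
      _ ≤ 4 * (gksSum s K C (fun _ => 1) * gksSum s K C (fun _ => 1)) *
          gksSum2 s K C (fun ξ χ => qVar2 p ξ χ * qVar2 r ξ χ) := mul_le_mul_of_nonneg_right hT hQ
      _ = _ := by ring
  exact le_of_mul_le_mul_right h' hZ2

/-- **The pair–pair covariance bound, unnormalised**: for `Kᵢ ≥ 0` on supports of at most two sites
(pair interactions AND fields),
`Z·Z⟨σ_aσ_zσ_xσ_y⟩ - Z⟨σ_aσ_z⟩Z⟨σ_xσ_y⟩ ≤ ∑_{p ∈ {a,z}, r ∈ {x,y}} (Z·Z⟨σ_pσ_r⟩ - Z⟨σ_p⟩Z⟨σ_r⟩)`.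
[cite: DuminilCopinGoswamiRaoufi2020, Lemma 1.2 (|A| = |B| = 2); GlimmJaffe1987 Cor. 4.3.2] -/
theorem gksSum_cov_spinPair_le_sum_truncated [DecidableEq ι] (hK : ∀ i ∈ s, 0 ≤ K i)
    (hC : ∀ i ∈ s, (C i).card ≤ 2) (a z x y : Λ) :
    gksSum s K C (fun _ => 1) * gksSum s K C (fun σ => spinPair a z σ * spinPair x y σ) -
        gksSum s K C (spinPair a z) * gksSum s K C (spinPair x y) ≤
      (gksSum s K C (spinPair a x) * gksSum s K C (fun _ => 1) -
          gksSum s K C (fun σ => spinAt a σ) * gksSum s K C (fun σ => spinAt x σ)) +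
        (gksSum s K C (spinPair a y) * gksSum s K C (fun _ => 1) -
          gksSum s K C (fun σ => spinAt a σ) * gksSum s K C (fun σ => spinAt y σ)) +
        (gksSum s K C (spinPair z x) * gksSum s K C (fun _ => 1) -
          gksSum s K C (fun σ => spinAt z σ) * gksSum s K C (fun σ => spinAt x σ)) +
        (gksSum s K C (spinPair z y) * gksSum s K C (fun _ => 1) -
          gksSum s K C (fun σ => spinAt z σ) * gksSum s K C (fun σ => spinAt y σ)) := by
  rw [cov_spinPair_eq_gksSum2]
  have h1 := gksSum2_ttqq_le_four_mul_qq s K C hK hC z y a x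
  have h2 := gksSum2_ttqq_le_four_mul_qq s K C hK hC z x a y
  have h3 := gksSum2_ttqq_le_four_mul_qq s K C hK hC a y z x
  have h4 := gksSum2_ttqq_le_four_mul_qq s K C hK hC a x z y
  rw [gksSum2_qVar2_mul] at h1 h2 h3 h4
  linarith

/-- **The pair–pair covariance bound** (Duminil-Copin–Goswami–Raoufi Lemma 1.2 for `|A| = |B| = 2`,
here for every ferromagnetic `ν_{Λ;K}` with pair couplings and fields `≥ 0`):
`⟨σ_aσ_zσ_xσ_y⟩ - ⟨σ_aσ_z⟩⟨σ_xσ_y⟩ ≤ ⟨σ_a;σ_x⟩ + ⟨σ_a;σ_y⟩ + ⟨σ_z;σ_x⟩ + ⟨σ_z;σ_y⟩`,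
`⟨σ_p;σ_r⟩ = ⟨σ_pσ_r⟩ - ⟨σ_p⟩⟨σ_r⟩`. [cite: DuminilCopinGoswamiRaoufi2020, Lemma 1.2 (|A| = |B| = 2); GlimmJaffe1987 Cor. 4.3.2; Lebowitz1974 (2.5b)] -/
theorem gksExpect_cov_spinPair_le_sum_truncated [DecidableEq ι] (hK : ∀ i ∈ s, 0 ≤ K i)
    (hC : ∀ i ∈ s, (C i).card ≤ 2) (a z x y : Λ) :
    gksExpect s K C (fun σ => spinPair a z σ * spinPair x y σ) -
        gksExpect s K C (spinPair a z) * gksExpect s K C (spinPair x y) ≤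
      (gksExpect s K C (spinPair a x) -
          gksExpect s K C (fun σ => spinAt a σ) * gksExpect s K C (fun σ => spinAt x σ)) +
        (gksExpect s K C (spinPair a y) -
          gksExpect s K C (fun σ => spinAt a σ) * gksExpect s K C (fun σ => spinAt y σ)) +
        (gksExpect s K C (spinPair z x) -
          gksExpect s K C (fun σ => spinAt z σ) * gksExpect s K C (fun σ => spinAt x σ)) +
        (gksExpect s K C (spinPair z y) -
          gksExpect s K C (fun σ => spinAt z σ) * gksExpect s K C (fun σ => spinAt y σ)) := by
  have hZ := gksSum_one_pos s K C
  set Z := gksSum s K C (fun _ => 1) with hZdef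
  have hun := gksSum_cov_spinPair_le_sum_truncated s K C hK hC a z x y
  rw [← hZdef] at hun
  simp only [gksExpect, ← hZdef]
  rw [← sub_nonneg] at hun ⊢
  have key : (gksSum s K C (spinPair a x) / Z -
          gksSum s K C (fun σ => spinAt a σ) / Z * (gksSum s K C (fun σ => spinAt x σ) / Z)) +
        (gksSum s K C (spinPair a y) / Z -
          gksSum s K C (fun σ => spinAt a σ) / Z * (gksSum s K C (fun σ => spinAt y σ) / Z)) +
        (gksSum s K C (spinPair z x) / Z -
          gksSum s K C (fun σ => spinAt z σ) / Z * (gksSum s K C (fun σ => spinAt x σ) / Z)) +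
        (gksSum s K C (spinPair z y) / Z -
          gksSum s K C (fun σ => spinAt z σ) / Z * (gksSum s K C (fun σ => spinAt y σ) / Z)) -
      (gksSum s K C (fun σ => spinPair a z σ * spinPair x y σ) / Z -
        gksSum s K C (spinPair a z) / Z * (gksSum s K C (spinPair x y) / Z)) =
      ((gksSum s K C (spinPair a x) * Z -
          gksSum s K C (fun σ => spinAt a σ) * gksSum s K C (fun σ => spinAt x σ)) +
        (gksSum s K C (spinPair a y) * Z -
          gksSum s K C (fun σ => spinAt a σ) * gksSum s K C (fun σ => spinAt y σ)) +
        (gksSum s K C (spinPair z x) * Z -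
          gksSum s K C (fun σ => spinAt z σ) * gksSum s K C (fun σ => spinAt x σ)) +
        (gksSum s K C (spinPair z y) * Z -
          gksSum s K C (fun σ => spinAt z σ) * gksSum s K C (fun σ => spinAt y σ)) -
      (Z * gksSum s K C (fun σ => spinPair a z σ * spinPair x y σ) -
        gksSum s K C (spinPair a z) * gksSum s K C (spinPair x y))) / (Z * Z) := by
    field_simp
  rw [key]
  exact div_nonneg hun (mul_pos hZ hZ).le

/-- The same bound with spin PRODUCTS over symmetric differences of singletons
(`σ_uσ_v = σ_{{u}∆{v}}`, `σ_u = σ_{{u}}`), the form matching the tree's set-indexed correlations.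
[cite: DuminilCopinGoswamiRaoufi2020, Lemma 1.2 (|A| = |B| = 2)] -/
theorem gksExpect_cov_symmDiff_le_sum_truncated [DecidableEq ι] (hK : ∀ i ∈ s, 0 ≤ K i)
    (hC : ∀ i ∈ s, (C i).card ≤ 2) (a z x y : Λ) :
    gksExpect s K C (spinProduct ((({a} : Finset Λ) ∆ {z}) ∆ (({x} : Finset Λ) ∆ {y}))) -
        gksExpect s K C (spinProduct (({a} : Finset Λ) ∆ {z})) *
          gksExpect s K C (spinProduct (({x} : Finset Λ) ∆ {y})) ≤
      (gksExpect s K C (spinProduct (({a} : Finset Λ) ∆ {x})) -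
          gksExpect s K C (spinProduct {a}) * gksExpect s K C (spinProduct {x})) +
        (gksExpect s K C (spinProduct (({a} : Finset Λ) ∆ {y})) -
          gksExpect s K C (spinProduct {a}) * gksExpect s K C (spinProduct {y})) +
        (gksExpect s K C (spinProduct (({z} : Finset Λ) ∆ {x})) -
          gksExpect s K C (spinProduct {z}) * gksExpect s K C (spinProduct {x})) +
        (gksExpect s K C (spinProduct (({z} : Finset Λ) ∆ {y})) -
          gksExpect s K C (spinProduct {z}) * gksExpect s K C (spinProduct {y})) := by
  have h := gksExpect_cov_spinPair_le_sum_truncated s K C hK hC a z x y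
  have hprod : (fun σ => spinPair a z σ * spinPair x y σ) =
      spinProduct ((({a} : Finset Λ) ∆ {z}) ∆ (({x} : Finset Λ) ∆ {y})) := by
    funext σ
    rw [spinPair_eq_spinProduct_singleton_symmDiff, spinPair_eq_spinProduct_singleton_symmDiff,
      spinProduct_mul_eq_spinProduct_symmDiff]
  rw [hprod, spinPair_eq_spinProduct_singleton_symmDiff, spinPair_eq_spinProduct_singleton_symmDiff,
    spinPair_eq_spinProduct_singleton_symmDiff, spinPair_eq_spinProduct_singleton_symmDiff,
    spinPair_eq_spinProduct_singleton_symmDiff, spinPair_eq_spinProduct_singleton_symmDiff,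
    spinAt_eq_spinProduct_singleton, spinAt_eq_spinProduct_singleton,
    spinAt_eq_spinProduct_singleton, spinAt_eq_spinProduct_singleton] at h
  exact h

end GKS

/-! ### §2 The finite-volume Ising model with free or plus boundary condition -/

section Ising

variable {V : Type*} [DecidableEq V] (G : SimpleGraph V) [G.LocallyFinite]

omit [G.LocallyFinite] in
/-- The trace of a singleton `{u}`, `u ∈ Λ`, is the singleton `{⟨u, hu⟩}`. [folklore] -/
private theorem inVol_singleton {Λ : Finset V} {u : V} (hu : u ∈ Λ) :
    inVol Λ ({u} : Finset V) = {(⟨u, hu⟩ : ↥Λ)} := by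
  ext z
  simp only [mem_inVol, Finset.mem_singleton]
  constructor
  · intro h; exact Subtype.ext h
  · intro h; rw [h]

omit [G.LocallyFinite] in
/-- Symmetric differences of subsets of `Λ` stay in `Λ`. [folklore] -/
private theorem symmDiff_subset_of_subset {Λ A B : Finset V} (hA : A ⊆ Λ) (hB : B ⊆ Λ) :
    A ∆ B ⊆ Λ := by
  intro x hx
  rw [Finset.mem_symmDiff] at hx
  rcases hx with ⟨h, -⟩ | ⟨h, -⟩
  · exact hA h
  · exact hB h

/-- **Energy–energy covariance bound for the finite-volume Ising model, free or plus boundary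
condition, `β, h ≥ 0`** (Duminil-Copin–Goswami–Raoufi Lemma 1.2 for `|A| = |B| = 2`, here by
Lebowitz' third inequality): for `u, v, u', v' ∈ Λ`, writing `σ_uσ_v = σ_{{u}∆{v}}`,
`⟨σ_uσ_v σ_{u'}σ_{v'}⟩ - ⟨σ_uσ_v⟩⟨σ_{u'}σ_{v'}⟩ ≤ ∑_{a ∈ {u,v}, b ∈ {u',v'}} (⟨σ_aσ_b⟩ - ⟨σ_a⟩⟨σ_b⟩)`.
[cite: DuminilCopinGoswamiRaoufi2020, Lemma 1.2 (|A| = |B| = 2); GlimmJaffe1987 Cor. 4.3.2] -/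
theorem isingCorr_cov_pair_le_sum_truncated {β h : ℝ} (hβ : 0 ≤ β) (hh : 0 ≤ h)
    {bc : BoundaryCondition V} (hbc : bc = .free ∨ bc = .plus) (Λ : Finset V) {u v u' v' : V}
    (hu : u ∈ Λ) (hv : v ∈ Λ) (hu' : u' ∈ Λ) (hv' : v' ∈ Λ) :
    isingCorr G Λ β h bc ((({u} : Finset V) ∆ {v}) ∆ (({u'} : Finset V) ∆ {v'})) -
        isingCorr G Λ β h bc (({u} : Finset V) ∆ {v}) * isingCorr G Λ β h bc (({u'} : Finset V) ∆ {v'}) ≤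
      (isingCorr G Λ β h bc (({u} : Finset V) ∆ {u'}) - isingCorr G Λ β h bc {u} * isingCorr G Λ β h bc {u'}) +
        (isingCorr G Λ β h bc (({u} : Finset V) ∆ {v'}) - isingCorr G Λ β h bc {u} * isingCorr G Λ β h bc {v'}) +
        (isingCorr G Λ β h bc (({v} : Finset V) ∆ {u'}) - isingCorr G Λ β h bc {v} * isingCorr G Λ β h bc {u'}) +
        (isingCorr G Λ β h bc (({v} : Finset V) ∆ {v'}) -
          isingCorr G Λ β h bc {v} * isingCorr G Λ β h bc {v'}) := by
  classical
  set s := isingIdx G Λ with hs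
  set K := gksCoupling G Λ β h bc with hK'
  set C := isingSupp Λ with hC'
  have hK : ∀ i ∈ s, 0 ≤ K i := gksCoupling_nonneg G hβ hh hbc
  have hC : ∀ i ∈ s, (C i).card ≤ 2 := fun i _ => card_isingSupp_le_two Λ i
  have hmain := gksExpect_cov_symmDiff_le_sum_truncated s K C hK hC
    (⟨u, hu⟩ : ↥Λ) ⟨v, hv⟩ ⟨u', hu'⟩ ⟨v', hv'⟩
  have su : ({u} : Finset V) ⊆ Λ := Finset.singleton_subset_iff.2 hu
  have sv : ({v} : Finset V) ⊆ Λ := Finset.singleton_subset_iff.2 hv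
  have su' : ({u'} : Finset V) ⊆ Λ := Finset.singleton_subset_iff.2 hu'
  have sv' : ({v'} : Finset V) ⊆ Λ := Finset.singleton_subset_iff.2 hv'
  -- every correlation through the dictionary `isingCorr_eq_gksExpect`
  have hcorr : ∀ {X : Finset V}, X ⊆ Λ →
      isingCorr G Λ β h bc X = gksExpect s K C (spinProduct (inVol Λ X)) :=
    fun hX => isingCorr_eq_gksExpect G Λ β h bc hX
  rw [hcorr (symmDiff_subset_of_subset (symmDiff_subset_of_subset su sv) (symmDiff_subset_of_subset su' sv')),
    hcorr (symmDiff_subset_of_subset su sv), hcorr (symmDiff_subset_of_subset su' sv'),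
    hcorr (symmDiff_subset_of_subset su su'), hcorr (symmDiff_subset_of_subset su sv'),
    hcorr (symmDiff_subset_of_subset sv su'), hcorr (symmDiff_subset_of_subset sv sv'),
    hcorr su, hcorr sv, hcorr su', hcorr sv']
  simp only [inVol_symmDiff, inVol_singleton hu, inVol_singleton hv, inVol_singleton hu',
    inVol_singleton hv']
  exact hmain

end Ising

/-! ### §3 The plus and free states of `ℤ^d` -/

section Zd

variable {d : ℕ}

/-- **Energy–energy covariance bound in the PLUS state of `ℤ^d`** (`β, h ≥ 0`; box limits of the
finite-volume bound): `⟨σ_uσ_vσ_{u'}σ_{v'}⟩⁺ - ⟨σ_uσ_v⟩⁺⟨σ_{u'}σ_{v'}⟩⁺ ≤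
∑_{a ∈ {u,v}, b ∈ {u',v'}} (⟨σ_aσ_b⟩⁺ - ⟨σ_a⟩⁺⟨σ_b⟩⁺)` (sets as symmetric differences of singletons).
[cite: DuminilCopinGoswamiRaoufi2020, Lemma 1.2 (|A| = |B| = 2, the plus state)] -/
theorem plusCorr_cov_pair_le_sum_truncated {β h : ℝ} (hβ : 0 ≤ β) (hh : 0 ≤ h) (u v u' v' : Site d) :
    plusCorr d β h ((({u} : Finset (Site d)) ∆ {v}) ∆ (({u'} : Finset (Site d)) ∆ {v'})) -
        plusCorr d β h (({u} : Finset (Site d)) ∆ {v}) * plusCorr d β h (({u'} : Finset (Site d)) ∆ {v'}) ≤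
      (plusCorr d β h (({u} : Finset (Site d)) ∆ {u'}) - plusCorr d β h {u} * plusCorr d β h {u'}) +
        (plusCorr d β h (({u} : Finset (Site d)) ∆ {v'}) - plusCorr d β h {u} * plusCorr d β h {v'}) +
        (plusCorr d β h (({v} : Finset (Site d)) ∆ {u'}) - plusCorr d β h {v} * plusCorr d β h {u'}) +
        (plusCorr d β h (({v} : Finset (Site d)) ∆ {v'}) - plusCorr d β h {v} * plusCorr d β h {v'}) := by
  have hl : ∀ A : Finset (Site d), Tendsto (fun L : ℕ => isingCorr (zdGraph d) (box d L) β h .plus A)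
      atTop (𝓝 (plusCorr d β h A)) := fun A => hasBoxLimit_isingCorr_plus_holds hβ hh A
  obtain ⟨L₀, hL₀⟩ := exists_forall_subset_box d ({u, v, u', v'} : Finset (Site d))
  refine le_of_tendsto_of_tendsto
    ((hl _).sub ((hl _).mul (hl _)))
    ((((hl _).sub ((hl _).mul (hl _))).add ((hl _).sub ((hl _).mul (hl _)))).add
      ((hl _).sub ((hl _).mul (hl _))) |>.add ((hl _).sub ((hl _).mul (hl _)))) ?_
  filter_upwards [eventually_ge_atTop L₀] with L hL
  have hsub := hL₀ L hL
  have hu : u ∈ box d L := hsub (by simp)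
  have hv : v ∈ box d L := hsub (by simp)
  have hu' : u' ∈ box d L := hsub (by simp)
  have hv' : v' ∈ box d L := hsub (by simp)
  exact isingCorr_cov_pair_le_sum_truncated (zdGraph d) hβ hh (Or.inr rfl) (box d L) hu hv hu' hv'

/-- **Energy–energy covariance bound in the FREE state of `ℤ^d`** (`β, h ≥ 0`).
[cite: DuminilCopinGoswamiRaoufi2020, Lemma 1.2 (|A| = |B| = 2); GlimmJaffe1987 Cor. 4.3.2] -/
theorem freeCorr_cov_pair_le_sum_truncated {β h : ℝ} (hβ : 0 ≤ β) (hh : 0 ≤ h) (u v u' v' : Site d) :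
    freeCorr d β h ((({u} : Finset (Site d)) ∆ {v}) ∆ (({u'} : Finset (Site d)) ∆ {v'})) -
        freeCorr d β h (({u} : Finset (Site d)) ∆ {v}) * freeCorr d β h (({u'} : Finset (Site d)) ∆ {v'}) ≤
      (freeCorr d β h (({u} : Finset (Site d)) ∆ {u'}) - freeCorr d β h {u} * freeCorr d β h {u'}) +
        (freeCorr d β h (({u} : Finset (Site d)) ∆ {v'}) - freeCorr d β h {u} * freeCorr d β h {v'}) +
        (freeCorr d β h (({v} : Finset (Site d)) ∆ {u'}) - freeCorr d β h {v} * freeCorr d β h {u'}) +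
        (freeCorr d β h (({v} : Finset (Site d)) ∆ {v'}) - freeCorr d β h {v} * freeCorr d β h {v'}) := by
  have hl : ∀ A : Finset (Site d), Tendsto (fun L : ℕ => isingCorr (zdGraph d) (box d L) β h .free A)
      atTop (𝓝 (freeCorr d β h A)) := fun A => hasBoxLimit_isingCorr_free_holds hβ hh A
  obtain ⟨L₀, hL₀⟩ := exists_forall_subset_box d ({u, v, u', v'} : Finset (Site d))
  refine le_of_tendsto_of_tendsto
    ((hl _).sub ((hl _).mul (hl _)))
    ((((hl _).sub ((hl _).mul (hl _))).add ((hl _).sub ((hl _).mul (hl _)))).add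
      ((hl _).sub ((hl _).mul (hl _))) |>.add ((hl _).sub ((hl _).mul (hl _)))) ?_
  filter_upwards [eventually_ge_atTop L₀] with L hL
  have hsub := hL₀ L hL
  have hu : u ∈ box d L := hsub (by simp)
  have hv : v ∈ box d L := hsub (by simp)
  have hu' : u' ∈ box d L := hsub (by simp)
  have hv' : v' ∈ box d L := hsub (by simp)
  exact isingCorr_cov_pair_le_sum_truncated (zdGraph d) hβ hh (Or.inl rfl) (box d L) hu hv hu' hv'

end Zd

end Literature.Probability.LatticeModels
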